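import Summits.CriticalPhenomena.PercolationContinuityZ3.Theorems.Transplant.Slab111VRide
import Summits.CriticalPhenomena.PercolationContinuityZ3.Theorems.Transplant.VPathKit
import HarnessLib

/-!
# Paths in the `(111)`-films `F_k`, VI: directed ride SEGMENTS, the `Clear` test, and HUB attachments

builds on p205010 (kernel theorem, internal audit signed; external expert review pending) — NOT used in this file.  Lane `prim-bschramm`, seat
`prim-bschramm-p2` (gen 36; class C1b; memo `HOME/bschramm/P2-LATTICES.md` §130); helper file (`--supports stmt-CriticalPhenomena-4575 --as helper`).
Toolkit for the HUB routings of the `(111)`-film instance of `HexShadow.ShapedLinkage 3` (gen 36 design: the cleared set is the lift of a radius-`2`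
hexagon around a HUB column `z`; the six annulus faces of the hub are pairwise column-disjoint helices; the vertices of the hub column — one every
third level — are adjacent to all six of them).  Everything is relative to a reference column `z` of class `c0` («Slab111VRide»: `vcol`, `FaceD`,
`rideV k z c0 F L` = the vertex of the face `F` at absolute level `L`).
* §1 **`segL k z c0 F a σ n`** — the ride of `F` from level `a` in direction `σ = ±1` through `n` steps (levels `a, a+σ, …, a+σn`): `segL_succ`,
  `mem_segL`, `segL_gpath`, level and column of its vertices, `segL_subset`;
* §2 **`Clear`**: a vertex off the three columns of `F` or outside a level range misses every segment of `F` inside that range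
  (`not_mem_segL_of_clear`); column-disjoint faces have disjoint segments (`FaceD.Disj`, `not_mem_segL_of_disj`);
* §3 the HUB: `hubV k z L = vl k z L`; it is adjacent to the ride vertex of level `L+1` of every face whose class-`1` column is a unit of `U`
  (`adj_hub_up`) and to the ride vertex of level `L−1` of every face whose class-`2` column is a unit of `−U` (`adj_hub_dn`); it lies on no
  segment of an annulus face (`hub_not_mem_segL`).
[cite: DuminilCopinSidoraviciusTassion2016, §2.3 (proof of Fact 2: the paths γ_u, γ_v, γ_w)] [cite: GrimmettPercolation1999, §1.6 p. 16]
-/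

noncomputable section

namespace Summit.CriticalPhenomena.PercolationContinuityZ3.Theorems.Transplant

open Literature.Probability.Percolation Literature.Probability.LatticeModels SimpleGraph
open scoped Classical

namespace Slab111

variable {k : ℕ}

/-! ## §1 Directed ride segments -/

/-- **The ride of the face `F` from level `a` in direction `σ` through `n` steps**: the vertices `rideV F (a + σ i)`, `i = 0, …, n`. [folklore] -/
def segL (k : ℕ) (z : Site 2) (c0 : ℤ) (F : FaceD) (a σ : ℤ) (n : ℕ) : List (slab111 k) :=
  (List.range (n + 1)).map fun i : ℕ => rideV k z c0 F (a + σ * (i : ℤ))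

/-- Membership in a segment. [folklore] -/
theorem mem_segL {z : Site 2} {c0 : ℤ} {F : FaceD} {a σ : ℤ} {n : ℕ} {v : slab111 k} :
    v ∈ segL k z c0 F a σ n ↔ ∃ i : ℕ, i ≤ n ∧ v = rideV k z c0 F (a + σ * (i : ℤ)) := by
  unfold segL
  rw [List.mem_map]
  constructor
  · rintro ⟨i, hi, rfl⟩
    rw [List.mem_range] at hi
    exact ⟨i, by omega, rfl⟩
  · rintro ⟨i, hi, rfl⟩
    exact ⟨i, List.mem_range.2 (by omega), rfl⟩

/-- A segment is non-empty. [folklore] -/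
theorem segL_ne_nil (z : Site 2) (c0 : ℤ) (F : FaceD) (a σ : ℤ) (n : ℕ) : segL k z c0 F a σ n ≠ [] := by
  simp [segL]

/-- The zero-step segment. [folklore] -/
@[simp] theorem segL_zero (z : Site 2) (c0 : ℤ) (F : FaceD) (a σ : ℤ) : segL k z c0 F a σ 0 = [rideV k z c0 F a] := by
  simp [segL]

/-- **Peeling the first vertex**: `segL a σ (n+1) = rideV a :: segL (a+σ) σ n`. [folklore] -/
theorem segL_succ (z : Site 2) (c0 : ℤ) (F : FaceD) (a σ : ℤ) (n : ℕ) :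
    segL k z c0 F a σ (n + 1) = rideV k z c0 F a :: segL k z c0 F (a + σ) σ n := by
  unfold segL
  rw [List.range_succ_eq_map, List.map_cons, List.map_map]
  congr 1
  · simp
  · apply List.map_congr_left
    intro i _
    simp only [Function.comp_apply, Nat.cast_succ]
    congr 1; ring

/-- The last vertex: `segL a σ (n+1) = segL a σ n ++ [rideV (a + σ(n+1))]`. [folklore] -/
theorem segL_succ' (z : Site 2) (c0 : ℤ) (F : FaceD) (a σ : ℤ) (n : ℕ) :
    segL k z c0 F a σ (n + 1) = segL k z c0 F a σ n ++ [rideV k z c0 F (a + σ * ((n : ℤ) + 1))] := by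
  unfold segL
  rw [List.range_succ, List.map_append, List.map_singleton]
  simp

/-- The head of a segment. [folklore] -/
theorem segL_head? (z : Site 2) (c0 : ℤ) (F : FaceD) (a σ : ℤ) (n : ℕ) : (segL k z c0 F a σ n).head? = some (rideV k z c0 F a) := by
  cases n with
  | zero => simp
  | succ n => rw [segL_succ]; rfl

variable {z : Site 2} {c0 : ℤ} {F : FaceD}

/-- **A segment is a self-avoiding film path** from `rideV a` to `rideV (a + σ n)`, for `σ = ±1` and all its levels inside `[0, k]`.
[cite: DuminilCopinSidoraviciusTassion2016, §2.3 (proof of Fact 2: γ_u, γ_v, γ_w)] -/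
theorem segL_gpath (hz : (3 : ℤ) ∣ z 0 + 2 * z 1 - c0) (hF : F.ok) {a σ : ℤ} (hσ : σ = 1 ∨ σ = -1) {n : ℕ}
    (h0 : 0 ≤ min a (a + σ * n)) (hk : max a (a + σ * n) ≤ k) :
    GPath (film k) (segL k z c0 F a σ n) (rideV k z c0 F a) (rideV k z c0 F (a + σ * (n : ℤ))) := by
  induction n with
  | zero => simpa using GPath.single (film k) (rideV k z c0 F a)
  | succ n ih =>
    have h0' : 0 ≤ min a (a + σ * n) := by rcases hσ with rfl | rfl <;> omega
    have hk' : max a (a + σ * n) ≤ k := by rcases hσ with rfl | rfl <;> omega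
    have hprev := ih h0' hk'
    have hstep : (film k).Adj (rideV k z c0 F (a + σ * n)) (rideV k z c0 F (a + σ * ((n : ℤ) + 1))) := by
      rcases hσ with rfl | rfl
      · have e : a + 1 * ((n : ℤ) + 1) = a + 1 * n + 1 := by ring
        rw [e]
        exact adj_rideV hz hF (by omega) (by omega)
      · have e : a + -1 * (n : ℤ) = a + -1 * ((n : ℤ) + 1) + 1 := by ring
        rw [e]
        exact (adj_rideV hz hF (by omega) (by omega)).symm
    rw [segL_succ']
    have hnew : rideV k z c0 F (a + σ * ((n : ℤ) + 1)) ∉ segL k z c0 F a σ n := by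
      intro hmem
      obtain ⟨i, hi, heq⟩ := mem_segL.1 hmem
      have h1 := lev_rideV (k := k) hz hF (L := a + σ * ((n : ℤ) + 1)) (by rcases hσ with rfl | rfl <;> omega)
        (by rcases hσ with rfl | rfl <;> omega)
      have h2 := lev_rideV (k := k) hz hF (L := a + σ * (i : ℤ)) (by rcases hσ with rfl | rfl <;> omega)
        (by rcases hσ with rfl | rfl <;> omega)
      rw [heq, h2] at h1
      rcases hσ with rfl | rfl <;> omega
    have := hprev.trans (GPath.pair hstep) (fun v hv hvl => by
      rcases List.mem_cons.1 hv with rfl | hv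
      · rfl
      · simp only [List.mem_singleton] at hv
        exact absurd (hv ▸ hvl) hnew)
    simpa using this

/-- The level of a segment vertex lies between `a` and `a + σn`. [folklore] -/
theorem lev_of_mem_segL (hz : (3 : ℤ) ∣ z 0 + 2 * z 1 - c0) (hF : F.ok) {a σ : ℤ} (hσ : σ = 1 ∨ σ = -1) {n : ℕ}
    (h0 : 0 ≤ min a (a + σ * n)) (hk : max a (a + σ * n) ≤ k) {v : slab111 k} (hv : v ∈ segL k z c0 F a σ n) :
    min a (a + σ * n) ≤ lev (v : Site 3) ∧ lev (v : Site 3) ≤ max a (a + σ * n) := by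
  obtain ⟨i, hi, rfl⟩ := mem_segL.1 hv
  rw [lev_rideV hz hF (by rcases hσ with rfl | rfl <;> omega) (by rcases hσ with rfl | rfl <;> omega)]
  rcases hσ with rfl | rfl <;> constructor <;> omega

/-- The shadow of a segment vertex lies over one of the three face columns. [folklore] -/
theorem sh_mem_of_mem_segL (hz : (3 : ℤ) ∣ z 0 + 2 * z 1 - c0) (hF : F.ok) {a σ : ℤ} (hσ : σ = 1 ∨ σ = -1) {n : ℕ}
    (h0 : 0 ≤ min a (a + σ * n)) (hk : max a (a + σ * n) ≤ k) {v : slab111 k} (hv : v ∈ segL k z c0 F a σ n) :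
    sh v = vcol z F.f0 ∨ sh v = vcol z F.f1 ∨ sh v = vcol z F.f2 := by
  obtain ⟨i, hi, rfl⟩ := mem_segL.1 hv
  rw [sh_rideV hz hF (by rcases hσ with rfl | rfl <;> omega) (by rcases hσ with rfl | rfl <;> omega)]
  rcases colAt_mem F (a + σ * i - c0) with h | h | h
  · exact Or.inl (by rw [h])
  · exact Or.inr (Or.inl (by rw [h]))
  · exact Or.inr (Or.inr (by rw [h]))

/-- A segment vertex is the ride vertex of its own level. [folklore] -/
theorem eq_rideV_of_mem_segL (hz : (3 : ℤ) ∣ z 0 + 2 * z 1 - c0) (hF : F.ok) {a σ : ℤ} (hσ : σ = 1 ∨ σ = -1) {n : ℕ}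
    (h0 : 0 ≤ min a (a + σ * n)) (hk : max a (a + σ * n) ≤ k) {v : slab111 k} (hv : v ∈ segL k z c0 F a σ n) :
    v = rideV k z c0 F (lev (v : Site 3)) := by
  obtain ⟨i, hi, rfl⟩ := mem_segL.1 hv
  rw [lev_rideV hz hF (by rcases hσ with rfl | rfl <;> omega) (by rcases hσ with rfl | rfl <;> omega)]

/-- **Segments inherit membership in a set** containing every ride vertex of the level range. [folklore] -/
theorem segL_subset {a σ : ℤ} (hσ : σ = 1 ∨ σ = -1) {n : ℕ} {S : Set (slab111 k)}
    (hS : ∀ L : ℤ, min a (a + σ * n) ≤ L → L ≤ max a (a + σ * n) → rideV k z c0 F L ∈ S) : ∀ v ∈ segL k z c0 F a σ n, v ∈ S := by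
  intro v hv
  obtain ⟨i, hi, rfl⟩ := mem_segL.1 hv
  exact hS _ (by rcases hσ with rfl | rfl <;> omega) (by rcases hσ with rfl | rfl <;> omega)

/-! ## §2 The `Clear` test and column-disjoint faces -/

/-- `x` lies over none of the three columns of the face `F`. [folklore] -/
def OffCols (z : Site 2) (F : FaceD) (x : slab111 k) : Prop := sh x ≠ vcol z F.f0 ∧ sh x ≠ vcol z F.f1 ∧ sh x ≠ vcol z F.f2

/-- **`x` is clear of the face `F` in the level range `[lo, hi]`**: off its columns, or at a level outside the range. [folklore] -/
def Clear (z : Site 2) (F : FaceD) (lo hi : ℤ) (x : slab111 k) : Prop := OffCols z F x ∨ lev (x : Site 3) < lo ∨ hi < lev (x : Site 3)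

/-- **A clear vertex misses every segment of `F` inside the range.** [folklore] -/
theorem not_mem_segL_of_clear (hz : (3 : ℤ) ∣ z 0 + 2 * z 1 - c0) (hF : F.ok) {a σ : ℤ} (hσ : σ = 1 ∨ σ = -1) {n : ℕ}
    (h0 : 0 ≤ min a (a + σ * n)) (hk : max a (a + σ * n) ≤ k) {lo hi : ℤ} (hlo : lo ≤ min a (a + σ * n)) (hhi : max a (a + σ * n) ≤ hi)
    {x : slab111 k} (hx : Clear z F lo hi x) : x ∉ segL k z c0 F a σ n := by
  intro hmem
  rcases hx with ⟨h0', h1', h2'⟩ | h | h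
  · rcases sh_mem_of_mem_segL hz hF hσ h0 hk hmem with e | e | e
    · exact h0' e
    · exact h1' e
    · exact h2' e
  · have := (lev_of_mem_segL hz hF hσ h0 hk hmem).1; omega
  · have := (lev_of_mem_segL hz hF hσ h0 hk hmem).2; omega

/-- **Column-disjoint faces** (no column in common). [folklore] -/
def FaceD.Disj (F G : FaceD) : Prop :=
  F.f0 ≠ G.f0 ∧ F.f0 ≠ G.f1 ∧ F.f0 ≠ G.f2 ∧ F.f1 ≠ G.f0 ∧ F.f1 ≠ G.f1 ∧ F.f1 ≠ G.f2 ∧ F.f2 ≠ G.f0 ∧ F.f2 ≠ G.f1 ∧ F.f2 ≠ G.f2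

/-- `FaceD.Disj` is decidable. [folklore] -/
instance (F G : FaceD) : Decidable (F.Disj G) := by unfold FaceD.Disj; infer_instance

/-- A vertex of a segment of `F` is off the columns of any face column-disjoint from `F`. [folklore] -/
theorem offCols_of_mem_segL (hz : (3 : ℤ) ∣ z 0 + 2 * z 1 - c0) (hF : F.ok) {G : FaceD} (hFG : F.Disj G) {a σ : ℤ} (hσ : σ = 1 ∨ σ = -1) {n : ℕ}
    (h0 : 0 ≤ min a (a + σ * n)) (hk : max a (a + σ * n) ≤ k) {v : slab111 k} (hv : v ∈ segL k z c0 F a σ n) : OffCols z G v := by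
  obtain ⟨d00, d01, d02, d10, d11, d12, d20, d21, d22⟩ := hFG
  have hinj := vcol_injective z
  rcases sh_mem_of_mem_segL hz hF hσ h0 hk hv with e | e | e <;> refine ⟨?_, ?_, ?_⟩ <;> rw [e] <;> intro h' <;>
    first | exact d00 (hinj h') | exact d01 (hinj h') | exact d02 (hinj h') | exact d10 (hinj h') | exact d11 (hinj h') |
      exact d12 (hinj h') | exact d20 (hinj h') | exact d21 (hinj h') | exact d22 (hinj h')

/-- **Segments of column-disjoint faces are disjoint.** [folklore] -/
theorem not_mem_segL_of_disj (hz : (3 : ℤ) ∣ z 0 + 2 * z 1 - c0) (hF : F.ok) {G : FaceD} (hG : G.ok) (hFG : F.Disj G)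
    {a σ : ℤ} (hσ : σ = 1 ∨ σ = -1) {n : ℕ} (h0 : 0 ≤ min a (a + σ * n)) (hk : max a (a + σ * n) ≤ k)
    {a' σ' : ℤ} (hσ' : σ' = 1 ∨ σ' = -1) {n' : ℕ} (h0' : 0 ≤ min a' (a' + σ' * n')) (hk' : max a' (a' + σ' * n') ≤ k)
    {v : slab111 k} (hv : v ∈ segL k z c0 F a σ n) : v ∉ segL k z c0 G a' σ' n' :=
  not_mem_segL_of_clear hz hG hσ' h0' hk' le_rfl le_rfl (Or.inl (offCols_of_mem_segL hz hF hFG hσ h0 hk hv))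

/-- A vertex over a column of `F` at a level of the range IS on the segment (converse of `Clear` for single levels): if `x = rideV F L` with
`L` in the range then `x ∈ segL`. [folklore] -/
theorem rideV_mem_segL {a σ : ℤ} (hσ : σ = 1 ∨ σ = -1) {n : ℕ} {L : ℤ} (h1 : min a (a + σ * n) ≤ L) (h2 : L ≤ max a (a + σ * n)) :
    rideV k z c0 F L ∈ segL k z c0 F a σ n := by
  rw [mem_segL]
  rcases hσ with rfl | rfl
  · refine ⟨(L - a).toNat, by omega, ?_⟩
    congr 1; omega
  · refine ⟨(a - L).toNat, by omega, ?_⟩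
    congr 1; omega

/-! ## §3 The hub -/

/-- **The hub vertex** of the reference column `z` at level `L` (meaningful for `L ≡ c0 (mod 3)`, `0 ≤ L ≤ k`). [folklore] -/
def hubV (k : ℕ) (z : Site 2) (L : ℤ) : slab111 k := vl k z L

/-- Admissibility of the hub vertex. [folklore] -/
theorem adm_hubV (hz : (3 : ℤ) ∣ z 0 + 2 * z 1 - c0) {L : ℤ} (hL : (3 : ℤ) ∣ L - c0) (h0 : 0 ≤ L) (hk : L ≤ k) : Adm k z L := by
  refine ⟨?_, h0, hk⟩
  have e : L - lvl z = (L - c0) - (z 0 + 2 * z 1 - c0) := by simp only [lvl]; ring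
  rw [e]; exact dvd_sub hL hz

/-- The shadow of the hub vertex is `z = vcol z (0,0)`. [folklore] -/
theorem sh_hubV (hz : (3 : ℤ) ∣ z 0 + 2 * z 1 - c0) {L : ℤ} (hL : (3 : ℤ) ∣ L - c0) (h0 : 0 ≤ L) (hk : L ≤ k) :
    sh (hubV k z L) = vcol z (0, 0) := by
  rw [hubV, sh_vl (adm_hubV hz hL h0 hk)]
  ext i; fin_cases i <;> simp

/-- The level of the hub vertex. [folklore] -/
theorem lev_hubV (hz : (3 : ℤ) ∣ z 0 + 2 * z 1 - c0) {L : ℤ} (hL : (3 : ℤ) ∣ L - c0) (h0 : 0 ≤ L) (hk : L ≤ k) :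
    lev ((hubV k z L : slab111 k) : Site 3) = L := by
  rw [hubV, lev_vl (adm_hubV hz hL h0 hk)]

/-- `p` is one of the three up-steps `U = {(1,0), (0,−1), (−1,1)}`. [folklore] -/
def IsUnitU (p : ℤ × ℤ) : Prop := p = (1, 0) ∨ p = (0, -1) ∨ p = (-1, 1)

/-- `p` is one of the three down-steps `−U = {(−1,0), (0,1), (1,−1)}`. [folklore] -/
def IsUnitD (p : ℤ × ℤ) : Prop := p = (-1, 0) ∨ p = (0, 1) ∨ p = (1, -1)

/-- `IsUnitU` is decidable. [folklore] -/
instance (p : ℤ × ℤ) : Decidable (IsUnitU p) := by unfold IsUnitU; infer_instance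
/-- `IsUnitD` is decidable. [folklore] -/
instance (p : ℤ × ℤ) : Decidable (IsUnitD p) := by unfold IsUnitD; infer_instance

/-- At a hub level `L ≡ c0`, the face column of class `L + 1 − c0` is `f1`. [folklore] -/
theorem colAt_hub_succ (F : FaceD) {L : ℤ} (hL : (3 : ℤ) ∣ L - c0) : colAt F (L + 1 - c0) = F.f1 := by
  unfold colAt
  have : (L + 1 - c0) % 3 = 1 := by omega
  simp [this]

/-- At a hub level `L ≡ c0`, the face column of class `L − 1 − c0` is `f2`. [folklore] -/
theorem colAt_hub_pred (F : FaceD) {L : ℤ} (hL : (3 : ℤ) ∣ L - c0) : colAt F (L - 1 - c0) = F.f2 := by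
  unfold colAt
  have h1 : (L - 1 - c0) % 3 ≠ 0 := by omega
  have h2 : (L - 1 - c0) % 3 ≠ 1 := by omega
  simp [h1, h2]

/-- **The hub is adjacent to the level-`L+1` vertex of every face whose class-`1` column is a unit up-step.** [folklore] -/
theorem adj_hub_up (hz : (3 : ℤ) ∣ z 0 + 2 * z 1 - c0) (hF : F.ok) (hU : IsUnitU F.f1) {L : ℤ} (hL : (3 : ℤ) ∣ L - c0) (h0 : 0 ≤ L)
    (hk : L + 1 ≤ k) : (film k).Adj (hubV k z L) (rideV k z c0 F (L + 1)) := by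
  have hadm := adm_hubV (k := k) hz hL h0 (by omega)
  have hadm' := adm_rideV (k := k) hz hF (L := L + 1) (by omega) hk
  rw [hubV, rideV]
  rw [colAt_hub_succ F hL] at hadm' ⊢
  rcases hU with e | e | e
  · have hv : vcol z F.f1 = z + u₁ := by ext i; fin_cases i <;> simp [vcol, e, u₁]
    rw [hv] at hadm' ⊢; exact adj_vl_u₁ hadm hadm'
  · have hv : vcol z F.f1 = z + u₂ := by ext i; fin_cases i <;> simp [vcol, e, u₂]
    rw [hv] at hadm' ⊢; exact adj_vl_u₂ hadm hadm'
  · have hv : vcol z F.f1 = z + u₃ := by ext i; fin_cases i <;> simp [vcol, e, u₃]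
    rw [hv] at hadm' ⊢; exact adj_vl_u₃ hadm hadm'

/-- **The hub is adjacent to the level-`L−1` vertex of every face whose class-`2` column is a unit down-step.** [folklore] -/
theorem adj_hub_dn (hz : (3 : ℤ) ∣ z 0 + 2 * z 1 - c0) (hF : F.ok) (hD : IsUnitD F.f2) {L : ℤ} (hL : (3 : ℤ) ∣ L - c0) (h0 : 1 ≤ L)
    (hk : L ≤ k) : (film k).Adj (rideV k z c0 F (L - 1)) (hubV k z L) := by
  have hadm := adm_hubV (k := k) hz hL (by omega) hk
  have hadm' := adm_rideV (k := k) hz hF (L := L - 1) (by omega) (by omega)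
  rw [hubV, rideV]
  rw [colAt_hub_pred F hL] at hadm' ⊢
  have eL : L = L - 1 + 1 := by ring
  rcases hD with e | e | e
  · have hv : z = vcol z F.f2 + u₁ := by ext i; fin_cases i <;> simp [vcol, e, u₁, Matrix.vecHead, Matrix.vecTail]
    rw [hv, eL] at hadm
    have := adj_vl_u₁ hadm' hadm
    rw [← hv, ← eL] at this; exact this
  · have hv : z = vcol z F.f2 + u₂ := by ext i; fin_cases i <;> simp [vcol, e, u₂, Matrix.vecHead, Matrix.vecTail]
    rw [hv, eL] at hadm
    have := adj_vl_u₂ hadm' hadm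
    rw [← hv, ← eL] at this; exact this
  · have hv : z = vcol z F.f2 + u₃ := by ext i; fin_cases i <;> simp [vcol, e, u₃, Matrix.vecHead, Matrix.vecTail]
    rw [hv, eL] at hadm
    have := adj_vl_u₃ hadm' hadm
    rw [← hv, ← eL] at this; exact this

/-- An ANNULUS face: none of its columns is the hub column `(0,0)`. [folklore] -/
def FaceD.OffHub (F : FaceD) : Prop := F.f0 ≠ (0, 0) ∧ F.f1 ≠ (0, 0) ∧ F.f2 ≠ (0, 0)

/-- `FaceD.OffHub` is decidable. [folklore] -/
instance (F : FaceD) : Decidable F.OffHub := by unfold FaceD.OffHub; infer_instance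

/-- **The hub lies on no segment of an annulus face.** [folklore] -/
theorem hub_not_mem_segL (hz : (3 : ℤ) ∣ z 0 + 2 * z 1 - c0) (hF : F.ok) (hoff : F.OffHub) {L : ℤ} (hL : (3 : ℤ) ∣ L - c0) (hL0 : 0 ≤ L)
    (hLk : L ≤ k) {a σ : ℤ} (hσ : σ = 1 ∨ σ = -1) {n : ℕ} (h0 : 0 ≤ min a (a + σ * n)) (hk : max a (a + σ * n) ≤ k) :
    hubV k z L ∉ segL k z c0 F a σ n := by
  refine not_mem_segL_of_clear hz hF hσ h0 hk le_rfl le_rfl (Or.inl ?_)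
  obtain ⟨h0', h1', h2'⟩ := hoff
  have hinj := vcol_injective z
  refine ⟨?_, ?_, ?_⟩ <;> rw [sh_hubV hz hL hL0 hLk] <;> intro h
  · exact h0' (hinj h).symm
  · exact h1' (hinj h).symm
  · exact h2' (hinj h).symm

/-- Two hub vertices at different levels differ. [folklore] -/
theorem hubV_ne (hz : (3 : ℤ) ∣ z 0 + 2 * z 1 - c0) {L L' : ℤ} (hL : (3 : ℤ) ∣ L - c0) (hL' : (3 : ℤ) ∣ L' - c0) (h0 : 0 ≤ L) (hk : L ≤ k)
    (h0' : 0 ≤ L') (hk' : L' ≤ k) (hne : L ≠ L') : hubV k z L ≠ hubV k z L' := by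
  intro h
  have := congrArg (fun x : slab111 k => lev (x : Site 3)) h
  simp only [lev_hubV hz hL h0 hk, lev_hubV hz hL' h0' hk'] at this
  exact hne this

/-- A vertex whose shadow is not the hub column is not a hub vertex. [folklore] -/
theorem ne_hubV_of_sh (hz : (3 : ℤ) ∣ z 0 + 2 * z 1 - c0) {L : ℤ} (hL : (3 : ℤ) ∣ L - c0) (h0 : 0 ≤ L) (hk : L ≤ k) {x : slab111 k}
    (hx : sh x ≠ vcol z (0, 0)) : x ≠ hubV k z L := fun h => hx (by rw [h, sh_hubV hz hL h0 hk])

/-- A vertex at another level is not the hub vertex of level `L`. [folklore] -/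
theorem ne_hubV_of_lev (hz : (3 : ℤ) ∣ z 0 + 2 * z 1 - c0) {L : ℤ} (hL : (3 : ℤ) ∣ L - c0) (h0 : 0 ≤ L) (hk : L ≤ k) {x : slab111 k}
    (hx : lev (x : Site 3) ≠ L) : x ≠ hubV k z L := fun h => hx (by rw [h, lev_hubV hz hL h0 hk])

end Slab111

end Summit.CriticalPhenomena.PercolationContinuityZ3.Theorems.Transplant

end
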